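import Literature.Computability.Complexity.HardcoreInapproximabilitySecondMomentGeneral
import Literature.Computability.Complexity.HardcoreInapproximabilitySecondMomentFormula
import Literature.Computability.Complexity.HardcoreInapproximabilitySecondMomentEps
import Literature.Computability.Complexity.HardcoreInapproximabilityFirstMomentCount
import HarnessLib

/-!
# The second-moment ratio of `Z_{a,b}(η)` is `slyRatioGen`

The combinatorial link between the counted moments of Sly's slice partition function and the
analytic ratio: the first moment (`sly_firstMoment_count`: every configuration is compatible with
`K₁,big^q K₁,small` realisations), the one-rectangle count in the ε-form (`pairAvoidSum_self_eq`),
the colour identity `K(g,h) · N! = K₁² ρ(g,h)` (`pairAvoidSum_mul_factorial_eq`), and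
`|Ω| Σ_ω Z(ω)² = (Σ_ω Z(ω))² · slyRatioGen` (`sly_secondMoment_ratio`).

## References
* [Sly2010] A. Sly, FOCS 2010 / arXiv:1005.5584, proof of Lemma 3.5 (eq. (e:gt2Moment)).
* [MosselWeitzWormald2008] E. Mossel, D. Weitz, N. Wormald, PTRF 143 (2009), §5.
-/

namespace Literature.Computability.Complexity

open Real Finset Nat



section ColourIdentity

/-- **The colour factor is the normalised two-rectangle count**: `K(g,h) · N! = K₁² · ρ(g,h)`.
[cite: Sly2010, proof of Lemma 3.5; MosselWeitzWormald2008, §5] -/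
theorem pairAvoidSum_mul_factorial_eq {N A B g h : ℕ} (hg : g ≤ A) (hh : h ≤ B)
    (hAN : A + A - g ≤ N) (hBN : B + B - h ≤ N) (hAB : A + B ≤ N) :
    (pairAvoidSum N (pairSizes N A A g) (pairSizes N B B h) : ℝ) * (N ! : ℝ) =
      (pairAvoidSum N (pairSizes N A A A) (pairSizes N B B B) : ℝ) ^ 2 * slyRho N A B g h := by
  have hK := pairAvoidSum_pairSizes_eq hg hh hAN hBN
  have hK' : (pairAvoidSum N (pairSizes N A A g) (pairSizes N B B h) : ℝ) =
      ((g ! * (A - g) ! * (A - g) ! * (N - (A + A - g)) ! * (N - (B + B - h)).choose g : ℕ) : ℝ) *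
        ∑ e ∈ range (A - g + 1),
          (((N - (B + B - h) - g).choose e * (B - h).choose (A - g - e) *
            (N - B - g - e).choose (A - g) : ℕ) : ℝ) := by
    exact_mod_cast hK
  rw [hK', pairAvoidSum_self_eq (by omega) (by omega)]
  unfold slyRho
  rw [← Finset.mul_sum]
  unfold slyB0 slyT
  push_cast
  -- binomials as factorial ratios
  have eA := Nat.cast_choose ℝ (show A ≤ N by omega)
  have eg := Nat.cast_choose ℝ (show g ≤ N by omega)
  have eP1 : (((N - g).choose (A - g) : ℕ) : ℝ) = ((N - g) ! : ℝ) / (((A - g) ! : ℝ) * ((N - A) ! : ℝ)) := by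
    rw [Nat.cast_choose ℝ (show A - g ≤ N - g by omega), show N - g - (A - g) = N - A by omega]
  have eP2 : (((N - A).choose (A - g) : ℕ) : ℝ) = ((N - A) ! : ℝ) / (((A - g) ! : ℝ) * ((N - (A + A - g)) ! : ℝ)) := by
    rw [Nat.cast_choose ℝ (show A - g ≤ N - A by omega), show N - A - (A - g) = N - (A + A - g) by omega]
  have hC : (((N - B).choose A : ℕ) : ℝ) ≠ 0 := by
    have : 0 < (N - B).choose A := Nat.choose_pos (by omega)
    exact_mod_cast this.ne'
  have f1 : ((A ! : ℕ) : ℝ) ≠ 0 := by positivity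
  have f2 : (((N - A) ! : ℕ) : ℝ) ≠ 0 := by positivity
  have f3 : ((g ! : ℕ) : ℝ) ≠ 0 := by positivity
  have f4 : (((N - g) ! : ℕ) : ℝ) ≠ 0 := by positivity
  have f5 : (((A - g) ! : ℕ) : ℝ) ≠ 0 := by positivity
  have f6 : (((N - (A + A - g)) ! : ℕ) : ℝ) ≠ 0 := by positivity
  have f7 : ((N ! : ℕ) : ℝ) ≠ 0 := by positivity
  rw [eA, eg, eP1, eP2]
  field_simp

end ColourIdentity

section Ratio

variable {n m' q : ℕ}

set_option maxHeartbeats 1600000 in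
open scoped Classical in
/-- **The second-moment ratio of `Z_{a,b}(η)` is `slyRatioGen`**:
`|Ω| · Σ_ω Z(ω)² = (Σ_ω Z(ω))² · slyRatioGen`, i.e. `E[Z²]/(EZ)² = Σ_{g,h} A(g,h) ρ_big^q ρ_small`.
[cite: Sly2010, proof of Lemma 3.5 (eq. (e:gt2Moment))] -/
theorem sly_secondMoment_ratio (n m' q a b : ℕ) (Ep Em : Finset (Fin m')) (hab : a + b ≤ n)
    (hab' : (a + Ep.card) + (b + Em.card) ≤ n + m') :
    ((((n + m') ! : ℕ) : ℝ) ^ q * ((n ! : ℕ) : ℝ)) *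
        ∑ ω : (Fin q → Equiv.Perm (Fin (n + m'))) × Equiv.Perm (Fin n), ((slyZab n m' q a b Ep Em ω : ℕ) : ℝ) ^ 2 =
      (∑ ω : (Fin q → Equiv.Perm (Fin (n + m'))) × Equiv.Perm (Fin n), ((slyZab n m' q a b Ep Em ω : ℕ) : ℝ)) ^ 2 *
        slyRatioGen n (n + m') q a b Ep.card Em.card := by
  set ep := Ep.card with hep
  set em := Em.card with hem
  have hepm : ep ≤ m' := by rw [hep]; exact le_trans (Finset.card_le_univ _) (by simp)
  have hemm : em ≤ m' := by rw [hem]; exact le_trans (Finset.card_le_univ _) (by simp)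
  -- the two counts, cast to `ℝ`
  have h2 := sly_secondMoment_count n m' q a b Ep Em
  have h1 := sly_firstMoment_count n m' q a b Ep Em
  rw [← hep, ← hem] at h2 h1
  have h2r : ∑ ω : (Fin q → Equiv.Perm (Fin (n + m'))) × Equiv.Perm (Fin n),
      ((slyZab n m' q a b Ep Em ω : ℕ) : ℝ) ^ 2 =
      ∑ g ∈ range (a + 1), ∑ h ∈ range (b + 1),
        ((n.choose a : ℝ) * ((a.choose g : ℝ) * ((n - a).choose (a - g) : ℝ))) *
          (((n.choose b : ℝ) * ((b.choose h : ℝ) * ((n - b).choose (b - h) : ℝ))) *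
            ((pairAvoidSum (n + m') (pairSizes (n + m') (a + ep) (a + ep) (g + ep)) (pairSizes (n + m') (b + em) (b + em) (h + em)) : ℝ) ^ q *
              (pairAvoidSum n (pairSizes n a a g) (pairSizes n b b h) : ℝ))) := by
    exact_mod_cast h2
  have h1r : ∑ ω : (Fin q → Equiv.Perm (Fin (n + m'))) × Equiv.Perm (Fin n),
      ((slyZab n m' q a b Ep Em ω : ℕ) : ℝ) =
      (n.choose a : ℝ) * (n.choose b : ℝ) *
        ((pairAvoidSum (n + m') (pairSizes (n + m') (a + ep) (a + ep) (a + ep)) (pairSizes (n + m') (b + em) (b + em) (b + em)) : ℝ) ^ q *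
          (pairAvoidSum n (pairSizes n a a a) (pairSizes n b b b) : ℝ)) := by
    exact_mod_cast h1
  rw [h2r, h1r]
  unfold slyRatioGen
  rw [Finset.mul_sum, Finset.mul_sum]
  refine Finset.sum_congr rfl fun g hg => ?_
  rw [Finset.mul_sum, Finset.mul_sum]
  refine Finset.sum_congr rfl fun h hh => ?_
  rw [Finset.mem_range, Nat.lt_succ_iff] at hg hh
  have hna : (n.choose a : ℝ) ≠ 0 := by
    have : 0 < n.choose a := Nat.choose_pos (by omega)
    exact_mod_cast this.ne'
  have hnb : (n.choose b : ℝ) ≠ 0 := by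
    have : 0 < n.choose b := Nat.choose_pos (by omega)
    exact_mod_cast this.ne'
  -- abbreviations
  set Kb := (pairAvoidSum (n + m') (pairSizes (n + m') (a + ep) (a + ep) (g + ep)) (pairSizes (n + m') (b + em) (b + em) (h + em)) : ℝ)
  set Ks := (pairAvoidSum n (pairSizes n a a g) (pairSizes n b b h) : ℝ)
  set K1b := (pairAvoidSum (n + m') (pairSizes (n + m') (a + ep) (a + ep) (a + ep)) (pairSizes (n + m') (b + em) (b + em) (b + em)) : ℝ)
  set K1s := (pairAvoidSum n (pairSizes n a a a) (pairSizes n b b b) : ℝ)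
  have hRHS : ((n.choose a : ℝ) * (n.choose b : ℝ) * (K1b ^ q * K1s)) ^ 2 *
      (slyAcoef n a b g h * slyRho (n + m') (a + ep) (b + em) (g + ep) (h + em) ^ q * slyRho n a b g h) =
      (n.choose a : ℝ) * (n.choose b : ℝ) * ((a.choose g : ℝ) * ((n - a).choose (a - g) : ℝ) *
        ((b.choose h : ℝ) * ((n - b).choose (b - h) : ℝ))) *
        (K1b ^ 2 * slyRho (n + m') (a + ep) (b + em) (g + ep) (h + em)) ^ q * (K1s ^ 2 * slyRho n a b g h) := by
    unfold slyAcoef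
    field_simp
    ring
  rw [hRHS]
  by_cases hdeg : a - g ≤ n - a ∧ b - h ≤ n - b
  · obtain ⟨hd1, hd2⟩ := hdeg
    have Lb := pairAvoidSum_mul_factorial_eq (N := n + m') (A := a + ep) (B := b + em) (g := g + ep) (h := h + em)
      (by omega) (by omega) (by omega) (by omega) (by omega)
    have Ls := pairAvoidSum_mul_factorial_eq (N := n) (A := a) (B := b) (g := g) (h := h)
      hg hh (by omega) (by omega) hab
    rw [← Lb, ← Ls, mul_pow]
    ring
  · -- a degenerate overlap: both sides vanish
    rcases not_and_or.mp hdeg with hd | hd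
    · have hz : ((n - a).choose (a - g) : ℝ) = 0 := by exact_mod_cast Nat.choose_eq_zero_of_lt (by omega)
      rw [hz]; ring
    · have hz : ((n - b).choose (b - h) : ℝ) = 0 := by exact_mod_cast Nat.choose_eq_zero_of_lt (by omega)
      rw [hz]; ring

end Ratio

end Literature.Computability.Complexity
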